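import Mathlib
import Literature.MathematicalPhysics.StatisticalMechanics.Crystallization
import Literature.MathematicalPhysics.StatisticalMechanics.LennardJonesClusters
import Literature.MathematicalPhysics.StatisticalMechanics.LocalMatchingCompactness
import Summits.AtomisticToContinuum.Crystallization.Theorems.BraggSlacknessRigidityHcpDiffractionRigidityWindowsOfEssentialPeriodicityAux

/-!
# Periodic windows from essential periodicity (stub `stub_windowsOfEssentialPeriodicity` of crux
# `HcpDiffractionRigidity`, item `stmt-AtomisticToContinuum-13166`, line `registered`)

**Stub B2b' of Half B (rational case).** Let `Λ ⊆ ℝ³` be `δ`-separated with `0 ∈ Λ`, contained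
in a lattice `M` (a discrete `ℤ`-submodule spanning `ℝ³`), and let `M' ≤ M` contain `k • M`
(`k ≥ 1`). Suppose `Λ` is *essentially `M'`-periodic*: along scales `L'_t → ∞`, for every
`z ∈ M'` the Gaussian mass of the points `s ∈ Λ` with `s + z ∉ Λ` is `o`(total Gaussian mass).
Then there is ONE periodic configuration `Q` (lattice of periods `M'`) such that for every radius
`R` a translate of `Λ` coincides with `Q.points` on the ball of radius `R` (in particular the
two point sets are `ε`-close there for every `ε > 0`).

* `HcpRigidityWindows.exists_complete_window` (Aux file): for every `n`, some window
  `Λ ∩ B(s₀(n), n+1)` is complete under all `z ∈ M'` with `|z| ≤ 2(n+1)` (finitely many, `M`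
  being discrete);
* `HcpRigidityWindows.exists_periodic_of_complete_windows`: reduce the recentred windows modulo
  `M'` with `ZSpan.fract` for a `ℤ`-basis of `M'`; the patterns are subsets of the finite set
  `M ∩ (fundamental domain)`, so one pattern `F₀` recurs for infinitely many `n` (pigeonhole), and
  the periodic configuration `F₀ + M'` has exactly the windows `(Λ - s₀(n)) ∩ B(0, n+1)` for
  these `n` (completeness of the windows gives the reverse inclusion).

All `[folklore]`.
-/

noncomputable section

namespace Summit.AtomisticToContinuum.Crystallization.Theorems

open Filter Metric Set
open scoped BigOperators Topology Classical
open Literature.MathematicalPhysics.StatisticalMechanics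

namespace HcpRigidityWindows

/-! ## Lattice preliminaries -/

/-- A submodule of a discrete submodule is discrete. [folklore] -/
theorem discreteTopology_of_le {M M' : Submodule ℤ (EuclideanSpace ℝ (Fin 3))}
    (hM : DiscreteTopology M) (h : M' ≤ M) : DiscreteTopology M' :=
  DiscreteTopology.of_subset (s := (M : Set (EuclideanSpace ℝ (Fin 3))))
    (t := (M' : Set (EuclideanSpace ℝ (Fin 3)))) hM h

/-- If `M` spans `ℝ³` over `ℝ` and `k • M ⊆ M'` for some `k ≥ 1`, then `M'` spans `ℝ³`.
[folklore] -/
theorem span_eq_top_of_smul_mem {M M' : Submodule ℤ (EuclideanSpace ℝ (Fin 3))}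
    (hM : Submodule.span ℝ (M : Set (EuclideanSpace ℝ (Fin 3))) = ⊤) {k : ℕ} (hk : 0 < k)
    (hkM : ∀ z ∈ M, (k : ℤ) • z ∈ M') :
    Submodule.span ℝ (M' : Set (EuclideanSpace ℝ (Fin 3))) = ⊤ := by
  rw [eq_top_iff, ← hM, Submodule.span_le]
  intro x hx
  have hk0 : (k : ℝ) ≠ 0 := by exact_mod_cast hk.ne'
  have h1 : ((k : ℤ) • x : EuclideanSpace ℝ (Fin 3)) ∈
      Submodule.span ℝ (M' : Set (EuclideanSpace ℝ (Fin 3))) :=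
    Submodule.subset_span (hkM x hx)
  have h2 := Submodule.smul_mem _ ((k : ℝ)⁻¹) h1
  rwa [← Int.cast_smul_eq_zsmul ℝ, Int.cast_natCast, inv_smul_smul₀ hk0] at h2

/-- A bounded set meets a discrete `ℤ`-submodule of `ℝ³` in a finite set. [folklore] -/
theorem finite_inter_of_isBounded (M : Submodule ℤ (EuclideanSpace ℝ (Fin 3))) [DiscreteTopology M]
    {K : Set (EuclideanSpace ℝ (Fin 3))} (hK : Bornology.IsBounded K) :
    (K ∩ (M : Set (EuclideanSpace ℝ (Fin 3)))).Finite :=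
  have H : IsClosed (X := EuclideanSpace ℝ (Fin 3)) M :=
    @AddSubgroup.isClosed_of_discrete _ _ _ _ _ M.toAddSubgroup
      (inferInstanceAs (DiscreteTopology M))
  Metric.finite_isBounded_inter_isClosed DiscreteTopology.isDiscrete hK H

/-! ## From complete windows to a periodic configuration -/

/-- **Periodic configuration from complete windows.** Let `Λ ⊆ ℝ³` be `δ`-separated and contained
in a discrete `ℤ`-submodule `M`, and let `M' ≤ M` be a full lattice such that for every `n` some
window `Λ ∩ B(s₀, n+1)`, `s₀ ∈ Λ`, is complete under the translations `z ∈ M'`, `|z| ≤ 2(n+1)`.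
Then there is a periodic configuration `Q` with lattice `M'` such that for every `R` some
translate `Λ - c`, `c ∈ Λ`, satisfies `Q.points ∩ B(0,R) ⊆ Λ - c` and `(Λ - c) ∩ B(0,R) ⊆ Q.points`.
Proof: reduce the recentred windows modulo `M'` (`ZSpan.fract`); the patterns live in the finite
set `M ∩ (fundamental domain)`, so one pattern recurs for infinitely many `n` (pigeonhole); take it
as the motif. [folklore] -/
theorem exists_periodic_of_complete_windows {Λ : Set (EuclideanSpace ℝ (Fin 3))} {δ : ℝ}
    (hδ : 0 < δ) (hΛ : ∀ p ∈ Λ, ∀ q ∈ Λ, p ≠ q → δ ≤ dist p q)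
    {M M' : Submodule ℤ (EuclideanSpace ℝ (Fin 3))}
    [DiscreteTopology M] (hΛM : Λ ⊆ M) (hM'M : M' ≤ M) [DiscreteTopology M'] [IsZLattice ℝ M']
    (hwin : ∀ n : ℕ, ∃ s₀ ∈ Λ, ∀ p ∈ Λ, dist p s₀ ≤ n + 1 →
      ∀ z ∈ M', ‖z‖ ≤ 2 * (n + 1) → p + z ∈ Λ) :
    ∃ Q : PeriodicConfiguration 3, ∀ R : ℝ, ∃ c ∈ Λ,
      (∀ q ∈ Q.points, ‖q‖ ≤ R → q + c ∈ Λ) ∧ (∀ p ∈ Λ, ‖p - c‖ ≤ R → p - c ∈ Q.points) := by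
  -- a `ℤ`-basis of `M'`, which is an `ℝ`-basis of `ℝ³`, and the associated reduction `fract`
  set b := (Module.Free.chooseBasis ℤ M').ofZLatticeBasis ℝ M' with hbdef
  have hbspan : Submodule.span ℤ (Set.range b) = M' := by
    rw [hbdef]; exact (Module.Free.chooseBasis ℤ M').ofZLatticeBasis_span ℝ
  have hfloor : ∀ x : EuclideanSpace ℝ (Fin 3), x - ZSpan.fract b x ∈ M' := fun x => by
    rw [ZSpan.fract_apply, sub_sub_cancel]; exact hbspan.le (ZSpan.floor b x).2
  have hfractM : ∀ x ∈ M, ZSpan.fract b x ∈ M := fun x hx => by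
    have h := M.sub_mem hx (hM'M (hfloor x)); rwa [sub_sub_cancel] at h
  -- the finite set of representatives
  have hA := finite_inter_of_isBounded M (ZSpan.fundamentalDomain_isBounded b)
  -- the windows and their patterns
  choose s₀ hs₀ hwin' using hwin
  have hWfin : ∀ n : ℕ,
      {p : EuclideanSpace ℝ (Fin 3) | p ∈ Λ ∧ dist p (s₀ n) ≤ n + 1}.Finite := fun n =>
    finite_of_forall_le_dist_of_subset_closedBall hδ (fun p hp q hq => hΛ p hp.1 q hq.1)
      (fun p hp => mem_closedBall.2 hp.2)
  set F : ℕ → Finset (EuclideanSpace ℝ (Fin 3)) := fun n =>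
    (hWfin n).toFinset.image fun p => ZSpan.fract b (p - s₀ n) with hFdef
  have hF : ∀ n x, x ∈ F n ↔ ∃ p ∈ Λ, dist p (s₀ n) ≤ n + 1 ∧ ZSpan.fract b (p - s₀ n) = x := by
    intro n x
    simp only [hFdef, Finset.mem_image, Set.Finite.mem_toFinset, Set.mem_setOf_eq, and_assoc]
  have hFA : ∀ n, F n ⊆ hA.toFinset := fun n x hx => by
    obtain ⟨p, hp, -, rfl⟩ := (hF n x).1 hx
    rw [Set.Finite.mem_toFinset]
    exact ⟨ZSpan.fract_mem_fundamentalDomain b _, hfractM _ (M.sub_mem (hΛM hp) (hΛM (hs₀ n)))⟩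
  -- pigeonhole: one pattern `F₀` occurs for an infinite set `N` of radii
  obtain ⟨F₀, hN⟩ := Finite.exists_infinite_fiber
    fun n : ℕ => (⟨F n, Finset.mem_powerset.2 (hFA n)⟩ : hA.toFinset.powerset)
  set N : Set ℕ :=
    (fun n : ℕ => (⟨F n, Finset.mem_powerset.2 (hFA n)⟩ : hA.toFinset.powerset)) ⁻¹' {F₀}
  have hNinf : N.Infinite := Set.infinite_coe_iff.1 hN
  have hNF : ∀ n ∈ N, F n = (F₀ : Finset (EuclideanSpace ℝ (Fin 3))) := fun n hn => by
    have h : (⟨F n, Finset.mem_powerset.2 (hFA n)⟩ : hA.toFinset.powerset) = F₀ := hn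
    rw [← h]
  obtain ⟨n₀, hn₀⟩ := hNinf.nonempty
  -- the motif
  have hF₀dom : ∀ x ∈ (F₀ : Finset (EuclideanSpace ℝ (Fin 3))), x ∈ ZSpan.fundamentalDomain b :=
      fun x hx => by
    have h := Finset.mem_powerset.1 F₀.2 hx
    rw [Set.Finite.mem_toFinset] at h
    exact h.1
  have hF₀ne : (F₀ : Finset (EuclideanSpace ℝ (Fin 3))).Nonempty := by
    refine ⟨ZSpan.fract b (s₀ n₀ - s₀ n₀), ?_⟩
    rw [← hNF n₀ hn₀, hF]
    exact ⟨s₀ n₀, hs₀ n₀, by rw [dist_self]; positivity, rfl⟩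
  -- the configuration
  let Q : PeriodicConfiguration 3 :=
    { lattice := M'
      discrete := inferInstance
      isZLattice := inferInstance
      motif := (F₀ : Finset (EuclideanSpace ℝ (Fin 3)))
      motif_nonempty := hF₀ne
      eq_of_sub_mem := fun x hx y hy hxy => by
        have hx' := ZSpan.fract_eq_self.2 (hF₀dom x hx)
        have hy' := ZSpan.fract_eq_self.2 (hF₀dom y hy)
        have h : ZSpan.fract b y = ZSpan.fract b x := by
          rw [ZSpan.fract_eq_fract, neg_add_eq_sub]; exact hbspan.ge hxy
        exact hx'.symm.trans (h.symm.trans hy') }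
  have hQ : ∀ q : EuclideanSpace ℝ (Fin 3), q ∈ Q.points ↔
      ∃ f ∈ (F₀ : Finset (EuclideanSpace ℝ (Fin 3))), ∃ m ∈ M', q = f + m := fun q => Iff.rfl
  refine ⟨Q, fun R => ?_⟩
  obtain ⟨n, hn, hRn⟩ := hNinf.exists_gt ⌈R⌉₊
  have hRn' : R ≤ n + 1 := by
    have h1 := Nat.le_ceil R
    have h2 : (⌈R⌉₊ : ℝ) < n := by exact_mod_cast hRn
    linarith
  refine ⟨s₀ n, hs₀ n, fun q hq hqR => ?_, fun p hp hpR => ?_⟩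
  · -- `Q.points ∩ B(0, R) ⊆ Λ - s₀ n`, by completeness of the window
    obtain ⟨f, hf, m, hm, rfl⟩ := (hQ _).1 hq
    rw [← hNF n hn, hF] at hf
    obtain ⟨p₁, hp₁, hp₁d, rfl⟩ := hf
    have hzM' : ZSpan.fract b (p₁ - s₀ n) + m - (p₁ - s₀ n) ∈ M' := by
      have h : ZSpan.fract b (p₁ - s₀ n) + m - (p₁ - s₀ n) =
          m - ((p₁ - s₀ n) - ZSpan.fract b (p₁ - s₀ n)) := by abel
      rw [h]; exact M'.sub_mem hm (hfloor _)
    have hzn : ‖ZSpan.fract b (p₁ - s₀ n) + m - (p₁ - s₀ n)‖ ≤ 2 * (n + 1) := by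
      have h1 : ‖p₁ - s₀ n‖ ≤ n + 1 := by rwa [← dist_eq_norm]
      linarith [norm_sub_le (ZSpan.fract b (p₁ - s₀ n) + m) (p₁ - s₀ n)]
    have h := hwin' n p₁ hp₁ hp₁d _ hzM' hzn
    convert h using 1; abel
  · -- `(Λ - s₀ n) ∩ B(0, R) ⊆ Q.points`
    refine (hQ _).2 ⟨ZSpan.fract b (p - s₀ n), ?_, (p - s₀ n) - ZSpan.fract b (p - s₀ n),
      hfloor _, by abel⟩
    rw [← hNF n hn, hF]
    exact ⟨p, hp, by rw [dist_eq_norm]; linarith, rfl⟩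

end HcpRigidityWindows

open HcpRigidityWindows in
/-- **Stub B2b' (periodic windows from essential periodicity).** Let `Λ ⊆ ℝ³` be `δ`-separated
with `0 ∈ Λ`, contained in a discrete `ℤ`-submodule `M` spanning `ℝ³`, and let `M' ≤ M` contain
`k • M` (`k ≥ 1`). If along scales `L'_t → ∞` for every `z ∈ M'` the Gaussian mass of the points
`s ∈ Λ` with `s + z ∉ Λ` is `o`(total Gaussian mass), then there is a periodic configuration `Q`
such that for every radius `R` (and every `ε > 0`) some translate `Λ - c` is `ε`-close to
`Q.points`, both ways, on the ball of radius `R` (indeed equal to it there): complete windows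
exist for every radius (`HcpRigidityWindows.exists_complete_window`, the translations of `M'` of
norm `≤ 2(n+1)` being finitely many), and their reductions modulo `M'` recur
(`HcpRigidityWindows.exists_periodic_of_complete_windows`). [folklore] -/
theorem stub_windowsOfEssentialPeriodicity : ∀ δ : ℝ, 0 < δ → ∀ Λ : Set (EuclideanSpace ℝ (Fin 3)), (∀ p ∈ Λ, ∀ q ∈ Λ, p ≠ q → δ ≤ dist p q) → (0 : EuclideanSpace ℝ (Fin 3)) ∈ Λ → ∀ M : Submodule ℤ (EuclideanSpace ℝ (Fin 3)), DiscreteTopology M → Submodule.span ℝ (M : Set (EuclideanSpace ℝ (Fin 3))) = ⊤ → Λ ⊆ M → ∀ (M' : Submodule ℤ (EuclideanSpace ℝ (Fin 3))) (k : ℕ), 0 < k → M' ≤ M → (∀ z ∈ M, (k : ℤ) • z ∈ M') → (∃ L' : ℕ → ℝ, Filter.Tendsto L' Filter.atTop Filter.atTop ∧ ∀ z ∈ M', Filter.Tendsto (fun t : ℕ => (∑' s : Λ, if (s : EuclideanSpace ℝ (Fin 3)) + z ∈ Λ then (0 : ℝ) else Real.exp (-(‖(s : EuclideanSpace ℝ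 (Fin 3))‖ ^ 2) / L' t ^ 2) ^ 2) / ∑' s : Λ, Real.exp (-(‖(s : EuclideanSpace ℝ (Fin 3))‖ ^ 2) / L' t ^ 2) ^ 2) Filter.atTop (nhds 0)) → ∃ Q : Literature.MathematicalPhysics.StatisticalMechanics.PeriodicConfiguration 3, ∀ R ε : ℝ, 0 < ε → ∃ c : EuclideanSpace ℝ (Fin 3), (∀ s ∈ Q.points, ‖s‖ ≤ R → ∃ p ∈ Λ, dist (p - c) s ≤ ε) ∧ (∀ p ∈ Λ, ‖p - c‖ ≤ R → ∃ s ∈ Q.points, dist (p - c) s ≤ ε) := by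
  intro δ hδ Λ hΛ h0 M hMd hspan hΛM M' k hk hM'M hkM hL
  obtain ⟨L', hL', hquiet⟩ := hL
  haveI : DiscreteTopology M := hMd
  haveI : DiscreteTopology M' := discreteTopology_of_le hMd hM'M
  haveI : IsZLattice ℝ M' := ⟨span_eq_top_of_smul_mem hspan hk hkM⟩
  -- complete windows of every radius
  have hwin : ∀ n : ℕ, ∃ s₀ ∈ Λ, ∀ p ∈ Λ, dist p s₀ ≤ n + 1 →
      ∀ z ∈ M', ‖z‖ ≤ 2 * (n + 1) → p + z ∈ Λ := by
    intro n
    have hZ : ({z : EuclideanSpace ℝ (Fin 3) | z ∈ M' ∧ ‖z‖ ≤ 2 * (n + 1)}).Finite := by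
      refine (finite_inter_of_isBounded M (isBounded_closedBall
        (x := (0 : EuclideanSpace ℝ (Fin 3))) (r := 2 * (n + 1)))).subset ?_
      rintro z ⟨hz, hzn⟩
      exact ⟨mem_closedBall_zero_iff.2 hzn, hM'M hz⟩
    obtain ⟨s₀, hs₀, hgood⟩ := exists_complete_window hδ hΛ h0 hL' hZ.toFinset
      (fun z hz => hquiet z (hZ.mem_toFinset.1 hz).1) (r := n + 1) (by positivity)
    exact ⟨s₀, hs₀, fun p hp hpd z hz hzn => hgood p hp hpd z (hZ.mem_toFinset.2 ⟨hz, hzn⟩)⟩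
  obtain ⟨Q, hQ⟩ := exists_periodic_of_complete_windows hδ hΛ hΛM hM'M hwin
  refine ⟨Q, fun R ε hε => ?_⟩
  obtain ⟨c, -, hB, hA⟩ := hQ R
  exact ⟨c, fun s hs hsR => ⟨s + c, hB s hs hsR, by simpa using hε.le⟩,
    fun p hp hpR => ⟨p - c, hA p hp hpR, by simpa using hε.le⟩⟩

end Summit.AtomisticToContinuum.Crystallization.Theorems

end
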